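import Literature.AlgebraicGeometry.Motives.WeilDiscriminantRealization
import HarnessLib

/-!
# Isotropic `K`-lines and planes for a Weil-type form over `ℚ(√-d)` (van Geemen 1994, 5.2–5.4)

Family `hodge`, layer `Literature/AlgebraicGeometry/Motives`; companion of
`Motives/WeilDiscriminant`, `Motives/WeilDiscriminantRealization` (`diagWeilForm`, `reCoord`,
`imCoord`) and `Motives/WeilDiscriminantSplit`. First of two lemma files
(`Motives/WeilFormMeyerSignature` is the second) behind the "free polarisation weights" lever:
for a Weil-type form `E` of signature `(n, n)` and rationals `r₁ r₂ > 0` the orthogonal sum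
`E ⊕ E_{(m₁ r₁, -m₂ r₂)}` on `V × K²` is SPLIT (has a totally isotropic `K`-subspace of half
dimension) for suitable positive integers `m₁, m₂` — the case of Landherr's classification
(van Geemen, LNM 1594, 5.4: signature and discriminant classify; (5.4.1)) that the Hodge summit's
Weil cruxes use to pass from a Weil `2n`-fold of arbitrary discriminant to a hyperbolic
`(2n+2)`-fold `A × B`. Sources: B. van Geemen, *An introduction to the Hodge conjecture for abelian
varieties*, LNM 1594 (1994), Lemma 5.2 (2) ("`H(x, y) := E(x, (√-d)·y) + √-d E(x, y)` […] is a
non-degenerate Hermitian form"), 5.4 ((5.4.1), "see [L]" = W. Landherr, Abh. Math. Sem. Hamburg 11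
(1936)); P. Deligne (J. S. Milne), LNM 900 (1982), §4, Cor. 4.2 ("split").

Setting. `K` a field with `[Algebra ℚ K]`, `α : K` with `α² = -d`, `d > 0`, `K = ℚ + ℚ α`
(hypothesis `hK`); `V` a `K`-module, a `ℚ`-module through the tower; `E` a `ℚ`-bilinear form on
`V`, ALTERNATING in the orientation `E x y = -E y x` (hypothesis `hE`) and of WEIL TYPE
`E (α x) (α y) = d E x y` (`hW`). The symmetric form of van Geemen's `H` is `S(x, y) := E x (α y)`
(`weilForm_apply_alpha_smul_symm`); a `K`-submodule is `H`-isotropic iff `E`-isotropic iff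
`S`-isotropic (`Motives/HyperbolicWeilType.forall_weilHermitianForm_eq_zero_iff`).

## What is here (everything PROVED; no definitions, no named facts)

* identities: `weilForm_apply_self` (`E x x = 0`), `weilForm_apply_alpha_smul_symm` (`S`
  symmetric), `weilForm_apply_alpha_alpha` (`S(x, α x) = 0`), `kSmul_eq_add_smul`
  (`(a + b α) x = a x + b α x`), `weilForm_apply_kSmul_alpha_kSmul` (**`S(c v, c v) =
  Nm(c) S(v, v)`**, `Nm(a + b α) = a² + d b²`), `weilForm_apply_kSmul_right/left_eq_zero`
  (`K`-orthogonality from `E(x, y) = E(x, α y) = 0`), `weilForm_eq_zero_of_apply_kSmul`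
  (anisotropic vectors have free `K`-multiples), `kSmul_mem_of_alpha_smul_mem` (`α`-stable
  `ℚ`-subspaces are `K`-stable), `weilForm_apply_add_alpha_add`;
* **one-step isotropic extension** `weilForm_isotropic_span_sup`: if `E|_{L × L} = 0` for a
  `K`-submodule `L`, `S(g, g) = 0` and `E(g, L) = 0`, then `E` vanishes on `(K g + L)²`;
  `weilForm_isotropic_span` (the `K`-line of an `S`-isotropic vector), and the dimension count
  `finrank_span_singleton_sup_eq` (`dim_K (K g + L) = dim_K L + 1`);
* the weights arithmetic `exists_nat_mul_sq_eq_of_pos` (`q = m s²`, `m ∈ ℕ_{>0}`, `s ∈ ℚ`) and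
  `exists_aimingWeights` (for `x, y > 0`, `r₁ r₂ > 0`: `m₁, m₂ ∈ ℕ_{>0}`, `s, s' ∈ ℚ²` with
  `x + Σ cᵢ sᵢ² = 0`, `-y + Σ cᵢ s'ᵢ² = 0`, `Σ cᵢ sᵢ s'ᵢ = 0`, `c = (m₁ r₁, -m₂ r₂)`);
* `diagWeilForm` on rational coordinate vectors of `K^ι` (`reCoord_algebraMap`,
  `imCoord_algebraMap`, `diagWeilForm_ratVec_ratVec` : `E_c(s, s') = 0`,
  `diagWeilForm_ratVec_alpha_ratVec` : `E_c(s, α s') = Σ cᵢ sᵢ s'ᵢ`).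

Not here: the Meyer step and the signature bookkeeping (`Motives/WeilFormMeyerSignature`), the
splitting theorem itself (Hodge summit, `Theorems/HeckePrymWeilWeilTenfoldsSqrtMinus11` +
`StubAimingArithmetic`: `exists_isotropic_of_signature_eq`), Landherr's full classification,
discriminants.

## References

* [vanGeemen1994HodgeAV] B. van Geemen, An introduction to the Hodge conjecture for abelian
  varieties, LNM 1594 (1994), Lemma 5.2, 5.4 (5.4.1).
* [Deligne1982HodgeCycles] P. Deligne (notes by J. S. Milne), Hodge cycles on abelian varieties,
  LNM 900 (1982), §4, Cor. 4.2.
-/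

noncomputable section

open Module

namespace Literature.AlgebraicGeometry.Motives

universe u v

variable {K : Type u} [Field K] [Algebra ℚ K] {α : K} {d : ℚ}
variable {V : Type v} [AddCommGroup V] [Module ℚ V] [Module K V] [IsScalarTower ℚ K V]

/-! ### Identities of an alternating Weil form -/

section WeilForm

variable (E : LinearMap.BilinForm ℚ V)

omit [Module K V] [IsScalarTower ℚ K V] in
/-- An alternating form vanishes on the diagonal. [folklore] -/
theorem weilForm_apply_self (hE : ∀ x y : V, E x y = -E y x) (x : V) : E x x = 0 := by
  have h := hE x x
  linarith

/-- The form `S(x, y) = E(x, α y)` is symmetric. [folklore] -/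
theorem weilForm_apply_alpha_smul_symm (hd : 0 < d) (hα : α * α = algebraMap ℚ K (-d))
    (hE : ∀ x y : V, E x y = -E y x) (hW : ∀ x y : V, E (α • x) (α • y) = d * E x y) (x y : V) :
    E x (α • y) = E y (α • x) := by
  rw [hE x (α • y), apply_smul_left_of_weil E hd.ne' hα hW, neg_neg]

/-- `S(x, α x) = E(x, α² x) = -d E(x, x) = 0`. [folklore] -/
theorem weilForm_apply_alpha_alpha (hα : α * α = algebraMap ℚ K (-d))
    (hE : ∀ x y : V, E x y = -E y x) (x : V) : E x (α • α • x) = 0 := by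
  rw [smul_smul, hα, algebraMap_smul, map_smul, smul_eq_mul, weilForm_apply_self E hE, mul_zero]

omit [Module ℚ V] [IsScalarTower ℚ K V] in
/-- `(a + b α) • x = a • x + b • (α • x)`. [folklore] -/
theorem kSmul_eq_add_smul [Module ℚ V] [IsScalarTower ℚ K V] (a b : ℚ) (x : V) :
    (algebraMap ℚ K a + algebraMap ℚ K b * α) • x = a • x + b • α • x := by
  rw [add_smul, mul_smul, algebraMap_smul, algebraMap_smul]

/-- **Norm times value**: `S(c v, c v) = (a² + d b²) S(v, v)` for `c = a + b α`. [folklore] -/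
theorem weilForm_apply_kSmul_alpha_kSmul (hα : α * α = algebraMap ℚ K (-d))
    (hE : ∀ x y : V, E x y = -E y x) (hW : ∀ x y : V, E (α • x) (α • y) = d * E x y)
    (a b : ℚ) (v : V) :
    E ((algebraMap ℚ K a + algebraMap ℚ K b * α) • v)
        (α • (algebraMap ℚ K a + algebraMap ℚ K b * α) • v) =
      (a ^ 2 + d * b ^ 2) * E v (α • v) := by
  have h2 : α • α • v = (-d) • v := by rw [smul_smul, hα, algebraMap_smul]
  have h3 : E (α • v) v = -E v (α • v) := hE _ _
  have h4 : E v v = 0 := weilForm_apply_self E hE v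
  have h5 : E (α • v) (α • v) = 0 := by rw [hW, h4, mul_zero]
  rw [kSmul_eq_add_smul, smul_add, smul_comm α a, smul_comm α b, h2]
  simp only [map_add, map_smul, LinearMap.add_apply, LinearMap.smul_apply, smul_eq_mul, h3, h4,
    h5]
  ring

/-- If `E x y = 0` and `E x (α y) = 0` then `E x (c y) = 0` for all `c ∈ K = ℚ + ℚ α`. [folklore] -/
theorem weilForm_apply_kSmul_right_eq_zero
    (hK : ∀ k : K, ∃ a b : ℚ, k = algebraMap ℚ K a + algebraMap ℚ K b * α) {x y : V}
    (h1 : E x y = 0) (h2 : E x (α • y) = 0) (c : K) : E x (c • y) = 0 := by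
  obtain ⟨a, b, rfl⟩ := hK c
  rw [kSmul_eq_add_smul, map_add, map_smul, map_smul, smul_eq_mul, smul_eq_mul, h1, h2, mul_zero,
    mul_zero, add_zero]

/-- If `E x y = 0` and `E (α x) y = 0` then `E (c x) y = 0` for all `c ∈ K = ℚ + ℚ α`. [folklore] -/
theorem weilForm_apply_kSmul_left_eq_zero
    (hK : ∀ k : K, ∃ a b : ℚ, k = algebraMap ℚ K a + algebraMap ℚ K b * α) {x y : V}
    (h1 : E x y = 0) (h2 : E (α • x) y = 0) (c : K) : E (c • x) y = 0 := by
  obtain ⟨a, b, rfl⟩ := hK c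
  rw [kSmul_eq_add_smul, map_add, map_smul, map_smul, LinearMap.add_apply, LinearMap.smul_apply,
    LinearMap.smul_apply, smul_eq_mul, smul_eq_mul, h1, h2, mul_zero, mul_zero, add_zero]

/-- **Anisotropic vectors have free `K`-multiples**: if `S(p, p) ≠ 0` and the multiple `c p` is
`K`-orthogonal to `p` (`E p (c p) = 0 = E (α p) (c p)`), then `c = 0`. [folklore] -/
theorem weilForm_eq_zero_of_apply_kSmul
    (hK : ∀ k : K, ∃ a b : ℚ, k = algebraMap ℚ K a + algebraMap ℚ K b * α)
    (hE : ∀ x y : V, E x y = -E y x) (hW : ∀ x y : V, E (α • x) (α • y) = d * E x y) {p : V}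
    (hp : E p (α • p) ≠ 0) {c : K} (h1 : E p (c • p) = 0) (h2 : E (α • p) (c • p) = 0) :
    c = 0 := by
  obtain ⟨a, b, rfl⟩ := hK c
  have h3 : E (α • p) p = -E p (α • p) := hE _ _
  have h1' : b * E p (α • p) = 0 := by
    rw [kSmul_eq_add_smul, map_add] at h1
    simpa only [map_smul, smul_eq_mul, weilForm_apply_self E hE, mul_zero, zero_add] using h1
  have h2' : -(a * E p (α • p)) = 0 := by
    rw [kSmul_eq_add_smul, map_add] at h2
    simpa only [map_smul, smul_eq_mul, hW, weilForm_apply_self E hE, mul_zero, add_zero, h3,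
      mul_neg] using h2
  rw [mul_eq_zero] at h1'
  rw [neg_eq_zero, mul_eq_zero] at h2'
  rw [h1'.resolve_right hp, h2'.resolve_right hp, map_zero, zero_mul, add_zero]

/-! ### Extending a totally isotropic `K`-submodule by one vector -/

/-- **One-step extension.** If `E` vanishes on `L × L` for a `K`-submodule `L`, `g` is
`S`-isotropic (`E g (α g) = 0`) and `E g l = 0` for all `l ∈ L`, then `E` vanishes on
`(K g + L) × (K g + L)`. [folklore] -/
theorem weilForm_isotropic_span_sup (hd : 0 < d) (hα : α * α = algebraMap ℚ K (-d))
    (hK : ∀ k : K, ∃ a b : ℚ, k = algebraMap ℚ K a + algebraMap ℚ K b * α)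
    (hE : ∀ x y : V, E x y = -E y x) (hW : ∀ x y : V, E (α • x) (α • y) = d * E x y)
    (L : Submodule K V) (hL : ∀ x ∈ L, ∀ y ∈ L, E x y = 0) (g : V) (hg : E g (α • g) = 0)
    (hgL : ∀ l ∈ L, E g l = 0) :
    ∀ x ∈ Submodule.span K {g} ⊔ L, ∀ y ∈ Submodule.span K {g} ⊔ L, E x y = 0 := by
  have h1 : ∀ (c : K), ∀ l ∈ L, E (c • g) l = 0 := fun c l hl => by
    refine weilForm_apply_kSmul_left_eq_zero E hK (hgL l hl) ?_ c
    rw [apply_smul_left_of_weil E hd.ne' hα hW, hgL _ (L.smul_mem α hl), neg_zero]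
  have h2 : ∀ c c' : K, E (c • g) (c' • g) = 0 := fun c c' => by
    refine weilForm_apply_kSmul_right_eq_zero E hK ?_ ?_ c'
    · refine weilForm_apply_kSmul_left_eq_zero E hK (weilForm_apply_self E hE g) ?_ c
      rw [hE, hg, neg_zero]
    · refine weilForm_apply_kSmul_left_eq_zero E hK hg ?_ c
      rw [hW, weilForm_apply_self E hE, mul_zero]
  intro x hx y hy
  obtain ⟨x1, hx1, x2, hx2, rfl⟩ := Submodule.mem_sup.1 hx
  obtain ⟨y1, hy1, y2, hy2, rfl⟩ := Submodule.mem_sup.1 hy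
  obtain ⟨c, rfl⟩ := Submodule.mem_span_singleton.1 hx1
  obtain ⟨c', rfl⟩ := Submodule.mem_span_singleton.1 hy1
  simp only [map_add, LinearMap.add_apply]
  rw [h2, h1 c y2 hy2, hE x2 (c' • g), h1 c' x2 hx2, hL x2 hx2 y2 hy2]
  simp

/-- The case `L = 0` of `weilForm_isotropic_span_sup`: the `K`-line of an `S`-isotropic vector is
totally `E`-isotropic. [folklore] -/
theorem weilForm_isotropic_span (hd : 0 < d) (hα : α * α = algebraMap ℚ K (-d))
    (hK : ∀ k : K, ∃ a b : ℚ, k = algebraMap ℚ K a + algebraMap ℚ K b * α)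
    (hE : ∀ x y : V, E x y = -E y x) (hW : ∀ x y : V, E (α • x) (α • y) = d * E x y)
    (g : V) (hg : E g (α • g) = 0) :
    ∀ x ∈ Submodule.span K {g}, ∀ y ∈ Submodule.span K {g}, E x y = 0 := by
  have h := weilForm_isotropic_span_sup E hd hα hK hE hW ⊥ (by simp) g hg
    (fun l hl => by rw [(Submodule.mem_bot K).1 hl, map_zero])
  rwa [sup_bot_eq] at h

/-- `ℚ`-subspaces stable under `α` are `K`-stable (`K = ℚ + ℚ α`). [folklore] -/
theorem kSmul_mem_of_alpha_smul_mem
    (hK : ∀ k : K, ∃ a b : ℚ, k = algebraMap ℚ K a + algebraMap ℚ K b * α)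
    (P : Submodule ℚ V) (hP : ∀ x ∈ P, α • x ∈ P) (c : K) {x : V} (hx : x ∈ P) : c • x ∈ P := by
  obtain ⟨a, b, rfl⟩ := hK c
  rw [kSmul_eq_add_smul]
  exact P.add_mem (P.smul_mem a hx) (P.smul_mem b (hP x hx))

/-- `S(p + q, p + q) = S(p, p) + S(q, q)` for `S`-orthogonal `p, q`. [folklore] -/
theorem weilForm_apply_add_alpha_add (hd : 0 < d) (hα : α * α = algebraMap ℚ K (-d))
    (hE : ∀ x y : V, E x y = -E y x) (hW : ∀ x y : V, E (α • x) (α • y) = d * E x y) {p q : V}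
    (h : E p (α • q) = 0) : E (p + q) (α • (p + q)) = E p (α • p) + E q (α • q) := by
  have h' : E q (α • p) = 0 := by rw [weilForm_apply_alpha_smul_symm E hd hα hE hW, h]
  simp only [smul_add, map_add, LinearMap.add_apply, h, h', add_zero, zero_add]

omit [Algebra ℚ K] [Module ℚ V] [IsScalarTower ℚ K V] in
/-- The dimension count of the one-step extension: `dim_K (K g + L) = dim_K L + 1` when no
non-zero `K`-multiple of `g ≠ 0` lies in `L`. [folklore] -/
theorem finrank_span_singleton_sup_eq [Module.Finite K V] (L : Submodule K V) {g : V} (hg : g ≠ 0)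
    (h : ∀ c : K, c • g ∈ L → c = 0) :
    finrank K ↥(Submodule.span K {g} ⊔ L) = finrank K L + 1 := by
  have hinf : Submodule.span K {g} ⊓ L = ⊥ := by
    rw [eq_bot_iff]
    rintro x ⟨hx1, hx2⟩
    obtain ⟨c, rfl⟩ := Submodule.mem_span_singleton.1 hx1
    rw [h c hx2, zero_smul]
    exact Submodule.zero_mem _
  have h1 := Submodule.finrank_sup_add_finrank_inf_eq (Submodule.span K {g}) L
  rw [hinf, finrank_bot, add_zero, finrank_span_singleton hg] at h1
  omega

end WeilForm

/-! ### The weights arithmetic -/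

/-- Every positive rational is `m s²` with `m` a positive integer and `s ∈ ℚ`. [folklore] -/
theorem exists_nat_mul_sq_eq_of_pos {q : ℚ} (hq : 0 < q) :
    ∃ m : ℕ, 0 < m ∧ ∃ s : ℚ, (m : ℚ) * s ^ 2 = q := by
  have hnum : 0 < q.num := Rat.num_pos.2 hq
  obtain ⟨N, hN⟩ := Int.eq_ofNat_of_zero_le hnum.le
  have hN0 : 0 < N := by
    rw [hN] at hnum
    exact_mod_cast hnum
  refine ⟨N * q.den, Nat.mul_pos hN0 q.den_pos, (q.den : ℚ)⁻¹, ?_⟩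
  have hden : (q.den : ℚ) ≠ 0 := by exact_mod_cast q.den_ne_zero
  have hNq : (N : ℚ) = q * q.den := by
    rw [Rat.mul_den_eq_num, hN, Int.cast_natCast]
  push_cast
  rw [hNq]
  field_simp

/-- **The free weights.** For `x, y > 0` and rationals `r₁, r₂` of the same sign there are positive
integers `m₁, m₂` and rational vectors `s, s' ∈ ℚ²` with, for the weights
`c = (m₁ r₁, -m₂ r₂)`: `x + Σ cᵢ sᵢ² = 0`, `-y + Σ cᵢ s'ᵢ² = 0`, `Σ cᵢ sᵢ s'ᵢ = 0`. [folklore] -/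
theorem exists_aimingWeights {x y r₁ r₂ : ℚ} (hx : 0 < x) (hy : 0 < y) (hr : 0 < r₁ * r₂) :
    ∃ m₁ m₂ : ℕ, 0 < m₁ ∧ 0 < m₂ ∧ ∃ s s' : Fin 2 → ℚ,
      x + ∑ i, ![(m₁ : ℚ) * r₁, -((m₂ : ℚ) * r₂)] i * (s i * s i) = 0 ∧
      -y + ∑ i, ![(m₁ : ℚ) * r₁, -((m₂ : ℚ) * r₂)] i * (s' i * s' i) = 0 ∧
      ∑ i, ![(m₁ : ℚ) * r₁, -((m₂ : ℚ) * r₂)] i * (s i * s' i) = 0 := by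
  have hr₁ : r₁ ≠ 0 := fun h => by simp [h] at hr
  rcases lt_or_gt_of_ne hr₁ with h1 | h1
  · have h2 : r₂ < 0 := by nlinarith
    obtain ⟨m₁, hm₁, σ, hσ⟩ := exists_nat_mul_sq_eq_of_pos (div_pos hx (neg_pos.2 h1))
    obtain ⟨m₂, hm₂, τ, hτ⟩ := exists_nat_mul_sq_eq_of_pos (div_pos hy (neg_pos.2 h2))
    rw [eq_div_iff (neg_ne_zero.2 h1.ne)] at hσ
    rw [eq_div_iff (neg_ne_zero.2 h2.ne)] at hτ
    refine ⟨m₁, m₂, hm₁, hm₂, ![σ, 0], ![0, τ], ?_, ?_, ?_⟩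
    · simp only [Fin.sum_univ_two, Matrix.cons_val_zero, Matrix.cons_val_one]
      linear_combination (-1 : ℚ) * hσ
    · simp only [Fin.sum_univ_two, Matrix.cons_val_zero, Matrix.cons_val_one]
      linear_combination hτ
    · simp [Fin.sum_univ_two]
  · have h2 : 0 < r₂ := by nlinarith
    obtain ⟨m₂, hm₂, σ, hσ⟩ := exists_nat_mul_sq_eq_of_pos (div_pos hx h2)
    obtain ⟨m₁, hm₁, τ, hτ⟩ := exists_nat_mul_sq_eq_of_pos (div_pos hy h1)
    rw [eq_div_iff h2.ne'] at hσ
    rw [eq_div_iff h1.ne'] at hτ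
    refine ⟨m₁, m₂, hm₁, hm₂, ![0, σ], ![τ, 0], ?_, ?_, ?_⟩
    · simp only [Fin.sum_univ_two, Matrix.cons_val_zero, Matrix.cons_val_one]
      linear_combination (-1 : ℚ) * hσ
    · simp only [Fin.sum_univ_two, Matrix.cons_val_zero, Matrix.cons_val_one]
      linear_combination hτ
    · simp [Fin.sum_univ_two]

/-! ### The diagonal Weil form on rational coordinate vectors -/

section Diag

variable (hd : 0 < d) (hα : α * α = algebraMap ℚ K (-d))
  (hK : ∀ k : K, ∃ a b : ℚ, k = algebraMap ℚ K a + algebraMap ℚ K b * α)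

/-- `re a = a` for `a ∈ ℚ`. [folklore] -/
theorem reCoord_algebraMap (a : ℚ) : reCoord hd hα hK (algebraMap ℚ K a) = a := by
  simpa using reCoord_apply hd hα hK a 0

/-- `im a = 0` for `a ∈ ℚ`. [folklore] -/
theorem imCoord_algebraMap (a : ℚ) : imCoord hd hα hK (algebraMap ℚ K a) = 0 := by
  simpa using imCoord_apply hd hα hK a 0

variable {ι : Type*} [Fintype ι]

/-- **Rational vectors are `E_c`-orthogonal**: `E_c(s, s') = Σ cᵢ (re sᵢ im s'ᵢ - im sᵢ re s'ᵢ) = 0`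
for `s, s' ∈ ℚ^ι ⊆ K^ι`. [folklore] -/
theorem diagWeilForm_ratVec_ratVec (c : ι → ℚ) (s s' : ι → ℚ) :
    diagWeilForm hd hα hK (Pi.basisFun K ι) c (fun i => algebraMap ℚ K (s i))
      (fun i => algebraMap ℚ K (s' i)) = 0 := by
  rw [diagWeilForm_apply]
  refine Finset.sum_eq_zero fun i _ => ?_
  rw [Basis.coord_apply, Basis.coord_apply, Pi.basisFun_repr, Pi.basisFun_repr,
    reCoord_algebraMap, imCoord_algebraMap, imCoord_algebraMap]
  ring

/-- **The symmetric form of `E_c` on rational vectors**: `E_c(s, α s') = Σ cᵢ sᵢ s'ᵢ` for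
`s, s' ∈ ℚ^ι ⊆ K^ι` (the diagonal Hermitian form `Σ cᵢ z̄ᵢ wᵢ`). [folklore] -/
theorem diagWeilForm_ratVec_alpha_ratVec (c : ι → ℚ) (s s' : ι → ℚ) :
    diagWeilForm hd hα hK (Pi.basisFun K ι) c (fun i => algebraMap ℚ K (s i))
      (α • fun i => algebraMap ℚ K (s' i)) = ∑ i, c i * (s i * s' i) := by
  rw [diagWeilForm_apply]
  refine Finset.sum_congr rfl fun i _ => ?_
  rw [Basis.coord_apply, Basis.coord_apply, Pi.basisFun_repr, Pi.basisFun_repr, Pi.smul_apply,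
    smul_eq_mul, reCoord_alpha_mul, imCoord_alpha_mul]
  simp only [reCoord_algebraMap, imCoord_algebraMap]
  ring

end Diag

end Literature.AlgebraicGeometry.Motives

end
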